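import Mathlib.Analysis.Calculus.Rademacher
import Mathlib.Analysis.Calculus.BumpFunction.FiniteDimension
import HarnessLib

/-!
# Integration by parts against a Lipschitz, compactly supported weight

Analysis/FluidPDE support file (serves the §10 enstrophy argument of Tao 2011, Thm. 10.1, which
integrates the enstrophy equation "against the Lipschitz, compactly supported `η` and
integrat[es] by parts as in Section 8 (interpreting derivatives of `η` in a distributional
sense)", arXiv:1108.1165 p. 31; Remark 10.3: "It will be important that `η` is Lipschitz
continuous but no better"). We prove the one integration by parts this requires, for a `C¹`
function `F` (no support condition) and a Lipschitz weight `η` with compact support on a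
finite-dimensional real inner product space:

  `∫ (∂ᵥF) η = −∫ F (∂ᵥη)`   (`Literature.Analysis.FluidPDE.integral_fderiv_apply_mul_eq_neg_integral_mul_lineDeriv`),

where `∂ᵥη = lineDeriv ℝ η x v` is the directional derivative, which exists for a.e. `x`
(Rademacher). Proof: multiply `F` by a smooth bump equal to `1` near the support of `η` to make
it Lipschitz with compact support, and apply Mathlib's integration by parts for two Lipschitz
functions (`LipschitzWith.integral_lineDeriv_mul_eq`, the lemma behind Rademacher's theorem).

## References

* T. Tao, arXiv:1108.1165 (`Tao2011`), §10, proof of Thm. 10.1 (p. 31) and Remark 10.3.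
* Mathlib, `Mathlib/Analysis/Calculus/Rademacher.lean` (`integral_lineDeriv_mul_eq`).
-/

noncomputable section

open MeasureTheory Set Function Filter Topology Metric
open scoped NNReal

namespace Literature.Analysis.FluidPDE

variable {E : Type*} [NormedAddCommGroup E] [InnerProductSpace ℝ E] [FiniteDimensional ℝ E]
  [MeasurableSpace E] [BorelSpace E]

omit [FiniteDimensional ℝ E] [MeasurableSpace E] [BorelSpace E] in
/-- The line derivative of a function vanishes outside its topological support. [folklore] -/
theorem lineDeriv_eq_zero_of_notMem_tsupport {η : E → ℝ} {x : E} (hx : x ∉ tsupport η) (w : E) :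
    lineDeriv ℝ η x w = 0 := by
  have h0 : η =ᶠ[𝓝 x] fun _ => 0 := by
    have : x ∈ (tsupport η)ᶜ := hx
    filter_upwards [(isClosed_tsupport η).isOpen_compl.mem_nhds this] with y hy
    exact image_eq_zero_of_notMem_tsupport hy
  rw [h0.lineDeriv_eq]
  simp [lineDeriv]

/-- **Integration by parts against a Lipschitz compactly supported weight.** For `F ∈ C¹(E)`
and `η` Lipschitz with compact support, `∫ DF(x)v · η(x) dx = −∫ F(x) · ∂ᵥη(x) dx`, where
`∂ᵥη = lineDeriv ℝ η x v` (defined a.e. by Rademacher's theorem; Lebesgue measure = any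
additive Haar measure). [folklore] -/
theorem integral_fderiv_apply_mul_eq_neg_integral_mul_lineDeriv (μ : Measure E) [μ.IsAddHaarMeasure]
    {F η : E → ℝ} (hF : ContDiff ℝ 1 F) {C : ℝ≥0} (hη : LipschitzWith C η)
    (hηc : HasCompactSupport η) (v : E) :
    ∫ x, fderiv ℝ F x v * η x ∂μ = -∫ x, F x * lineDeriv ℝ η x v ∂μ := by
  -- a bump `χ = 1` on a neighbourhood of the support of `η`
  obtain ⟨R, hR⟩ := hηc.isCompact.isBounded.subset_closedBall (0 : E)
  set R' : ℝ := max R 0 with hR'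
  have hsub : tsupport η ⊆ closedBall (0 : E) R' :=
    hR.trans (closedBall_subset_closedBall (le_max_left _ _))
  let χ : ContDiffBump (0 : E) := ⟨R' + 1, R' + 2, by positivity, by linarith⟩
  have hχ1 : ∀ x ∈ closedBall (0 : E) (R' + 1), χ x = 1 := fun x hx => χ.one_of_mem_closedBall hx
  have hχnhds : ∀ x ∈ closedBall (0 : E) R', (fun y => χ y * F y) =ᶠ[𝓝 x] F := by
    intro x hx
    have hb : x ∈ ball (0 : E) (R' + 1) := by
      rw [mem_ball]; rw [mem_closedBall] at hx; linarith
    filter_upwards [χ.eventuallyEq_one_of_mem_ball hb] with y hy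
    rw [hy, Pi.one_apply, one_mul]
  -- the truncated function is `C¹` with compact support, hence Lipschitz
  have hf1 : ContDiff ℝ 1 fun y => χ y * F y := (χ.contDiff (n := 1)).mul hF
  have hfc : HasCompactSupport fun y => χ y * F y := χ.hasCompactSupport.mul_right
  obtain ⟨D, hD⟩ := hf1.lipschitzWith_of_hasCompactSupport hfc one_ne_zero
  -- Mathlib's integration by parts for two Lipschitz functions
  have key := LipschitzWith.integral_lineDeriv_mul_eq (μ := μ) hD hη hηc v
  -- identify the left-hand sides
  have hL : ∀ x, lineDeriv ℝ (fun y => χ y * F y) x v * η x = fderiv ℝ F x v * η x := by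
    intro x
    by_cases hx : η x = 0
    · rw [hx, mul_zero, mul_zero]
    · have hxs : x ∈ closedBall (0 : E) R' := hsub (subset_tsupport _ hx)
      rw [((hf1.differentiable one_ne_zero) x).lineDeriv_eq_fderiv, (hχnhds x hxs).fderiv_eq]
  -- identify the right-hand sides almost everywhere (where `η` is differentiable)
  have hRae : ∀ᵐ x ∂μ, lineDeriv ℝ η x (-v) * (χ x * F x) = -(F x * lineDeriv ℝ η x v) := by
    filter_upwards [hη.ae_differentiableAt (μ := μ)] with x hx
    by_cases hxs : x ∈ closedBall (0 : E) R'
    · rw [hχ1 x (closedBall_subset_closedBall (by linarith) hxs), one_mul,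
        hx.lineDeriv_eq_fderiv, hx.lineDeriv_eq_fderiv, map_neg]
      ring
    · have hxt : x ∉ tsupport η := fun h => hxs (hsub h)
      rw [lineDeriv_eq_zero_of_notMem_tsupport hxt, lineDeriv_eq_zero_of_notMem_tsupport hxt]
      ring
  calc ∫ x, fderiv ℝ F x v * η x ∂μ = ∫ x, lineDeriv ℝ (fun y => χ y * F y) x v * η x ∂μ := by
        simp_rw [hL]
    _ = ∫ x, lineDeriv ℝ η x (-v) * (χ x * F x) ∂μ := key
    _ = ∫ x, -(F x * lineDeriv ℝ η x v) ∂μ := integral_congr_ae hRae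
    _ = -∫ x, F x * lineDeriv ℝ η x v ∂μ := integral_neg _

end Literature.Analysis.FluidPDE

end
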